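import Summits.MatrixMultiplication.OmegaCensus.BoxBadSmallGroups2

/-!
# ω-census, family (b3): Cayley-table groups as kernel-computable types with CHEAP group axioms (bit-packed table, associativity on generators)

HONEST FRAMING (pub-omega census; verbatim): lottery ticket; floor = certified bounds/negative ranges.
Census BOOKKEEPING machinery (pub-omega kernel-l4 gen 15, task K-4).  The order-`32` table models (`BoxBadOrder32Minimal*`: `structure
T32_k`, table as a `List (List ℕ)`, axioms by `decide` over `32³` triples) do not scale to order `64`.  This file provides ONE generic
type **`TG n w T I`** — carrier `Fin n`, multiplication `a * b = (T >>> (w·(n·a + b))) % n` read from a single numeral `T` packing the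
Cayley table at `w` bits per entry (row-major, identity = `0`), inverses from a second numeral `I` — and a constructor
**`TG.groupOfChecks`** turning four `decide`-able Boolean checks into a `Group` instance:
* `oneMulB` (`0 * a = a`, `n` checks), `invMulB` (`a⁻¹ * a = 0`, `n` checks);
* `assocGenB S` — associativity `a (b c) = (a b) c` only for LEFT factors `a` in a generating list `S` (`|S|·n²` checks instead of `n³`);
* `genB S` — the right-multiplication closure of `{0}` under `S` is everything (`n` rounds of `reach`).
Correctness (`TG.mul_assoc_of_checks`, no `Prop`-valued definition introduced): the set of `a` satisfying `∀ b c, a (b c) = (a b) c` contains `1` (by `oneMulB`) and is closed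
under right multiplication by good elements (four applications of the hypothesis), so it contains the closure of `{1}` under `S`,
which is everything by `genB`.  Kernel cost per lookup is one big-numeral shift (GMP-backed), so an order-`64` table costs seconds.
Used by the sequel files for the four CLASS-`3` minimal bad `2`-groups of order `64` (SmallGroup(64, k), k = 25, 30, 31, 45), whose
tables come from GAP (kit j264654).  Nothing here is progress on `ω`.
-/

namespace Summit.MatrixMultiplication.OmegaCensus

/-- Table group: carrier `Fin n`; `T` packs the Cayley table (`w` bits per entry, row-major, identity `0`), `I` the inverse table.
[folklore] -/
structure TG (n w T I : ℕ) where
  /-- element index (identity = `0`) -/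
  i : Fin n
  deriving DecidableEq

namespace TG

variable {n w T I : ℕ}

/-- Two elements agree iff their indices agree. [folklore] -/
@[ext] theorem ext {x y : TG n w T I} (h : x.i = y.i) : x = y := by
  cases x; cases y; congr

/-- `TG n w T I ≃ Fin n`. [folklore] -/
def equivFin : TG n w T I ≃ Fin n := ⟨fun x => x.i, fun i => ⟨i⟩, fun _ => rfl, fun _ => rfl⟩

/-- Finite, through `equivFin`. [folklore] -/
instance : Fintype (TG n w T I) := Fintype.ofEquiv _ equivFin.symm

/-- `|TG n w T I| = n`. [folklore] -/
theorem card : Fintype.card (TG n w T I) = n := by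
  rw [Fintype.ofEquiv_card, Fintype.card_fin]

variable [NeZero n]

/-- Table lookup `a·b`: entry `(a, b)` of the packed table. [folklore] -/
def tab (n w T : ℕ) [NeZero n] (a b : Fin n) : Fin n :=
  ⟨(T >>> (w * (n * a.val + b.val))) % n, Nat.mod_lt _ (Nat.pos_of_ne_zero (NeZero.ne n))⟩

/-- Inverse lookup: entry `a` of the packed inverse table. [folklore] -/
def itab (n w I : ℕ) [NeZero n] (a : Fin n) : Fin n :=
  ⟨(I >>> (w * a.val)) % n, Nat.mod_lt _ (Nat.pos_of_ne_zero (NeZero.ne n))⟩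

/-- Multiplication by the table. [folklore] -/
instance : Mul (TG n w T I) := ⟨fun x y => ⟨tab n w T x.i y.i⟩⟩
/-- Identity = index `0`. [folklore] -/
instance : One (TG n w T I) := ⟨⟨⟨0, Nat.pos_of_ne_zero (NeZero.ne n)⟩⟩⟩
/-- Inverse by the inverse table. [folklore] -/
instance : Inv (TG n w T I) := ⟨fun x => ⟨itab n w I x.i⟩⟩

/-- The multiplication, unfolded. [folklore] -/
theorem mul_def (x y : TG n w T I) : x * y = ⟨tab n w T x.i y.i⟩ := rfl
/-- The identity, unfolded. [folklore] -/
theorem one_def : (1 : TG n w T I) = ⟨⟨0, Nat.pos_of_ne_zero (NeZero.ne n)⟩⟩ := rfl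
/-- The inverse, unfolded. [folklore] -/
theorem inv_def (x : TG n w T I) : x⁻¹ = ⟨itab n w I x.i⟩ := rfl

/-- Check: `0 * a = a` for all `a`. [folklore] -/
def oneMulB (n w T : ℕ) [NeZero n] : Bool :=
  (List.finRange n).all fun a => tab n w T ⟨0, Nat.pos_of_ne_zero (NeZero.ne n)⟩ a == a

/-- Check: `a⁻¹ * a = 0` for all `a`. [folklore] -/
def invMulB (n w T I : ℕ) [NeZero n] : Bool :=
  (List.finRange n).all fun a => (tab n w T (itab n w I a) a).val == 0

/-- Check: associativity `a (b c) = (a b) c` for left factors `a ∈ S`. [folklore] -/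
def assocGenB (n w T : ℕ) [NeZero n] (S : List (Fin n)) : Bool :=
  S.all fun a => (List.finRange n).all fun b => (List.finRange n).all fun c =>
    tab n w T a (tab n w T b c) == tab n w T (tab n w T a b) c

/-- One closure round: `R ∪ R·S`. [folklore] -/
def step (n w T : ℕ) [NeZero n] (S R : List (Fin n)) : List (Fin n) :=
  (R ++ R.flatMap fun r => S.map fun s => tab n w T r s).dedup

/-- `k` closure rounds from `{0}`. [folklore] -/
def reach (n w T : ℕ) [NeZero n] (S : List (Fin n)) : ℕ → List (Fin n)
  | 0 => [⟨0, Nat.pos_of_ne_zero (NeZero.ne n)⟩]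
  | k + 1 => step n w T S (reach n w T S k)

/-- Check: `n` closure rounds from `{0}` under right multiplication by `S` reach every element. [folklore] -/
def genB (n w T : ℕ) [NeZero n] (S : List (Fin n)) : Bool :=
  (List.finRange n).all fun g => decide (g ∈ reach n w T S n)

/-- Left-associative elements (`x (y z) = (x y) z` for all `y, z`) are closed under multiplication. [folklore] -/
theorem good_mul {x s : TG n w T I} (hx : ∀ y z : TG n w T I, x * (y * z) = x * y * z)
    (hs : ∀ y z : TG n w T I, s * (y * z) = s * y * z) (y z : TG n w T I) : x * s * (y * z) = x * s * y * z := by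
  rw [← hx s (y * z), hs y z, hx (s * y) z, hx s y]

/-- `1` is left-associative when `1 * a = a` holds. [folklore] -/
theorem good_one (h1 : ∀ a : TG n w T I, 1 * a = a) (y z : TG n w T I) : 1 * (y * z) = 1 * y * z := by
  rw [h1, h1]

/-- `oneMulB ⇒ 1 * a = a`. [folklore] -/
theorem one_mul_of_check (h : oneMulB n w T = true) (a : TG n w T I) : 1 * a = a := by
  have := List.all_eq_true.mp h a.i (List.mem_finRange _)
  apply ext
  simpa [mul_def, one_def] using this

/-- `invMulB ⇒ a⁻¹ * a = 1`. [folklore] -/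
theorem inv_mul_of_check (h : invMulB n w T I = true) (a : TG n w T I) : a⁻¹ * a = 1 := by
  have := List.all_eq_true.mp h a.i (List.mem_finRange _)
  apply ext
  rw [mul_def, inv_def, one_def]
  exact Fin.ext (by simpa using this)

/-- `assocGenB S ⇒` every `⟨s⟩`, `s ∈ S`, is left-associative. [folklore] -/
theorem good_of_mem {S : List (Fin n)} (h : assocGenB n w T S = true) {s : Fin n} (hs : s ∈ S) (y z : TG n w T I) :
    (⟨s⟩ : TG n w T I) * (y * z) = ⟨s⟩ * y * z := by
  have := List.all_eq_true.mp (List.all_eq_true.mp (List.all_eq_true.mp h s hs) y.i (List.mem_finRange _)) z.i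
    (List.mem_finRange _)
  apply ext
  simpa [mul_def] using this

/-- Every element reached in `k` rounds is left-associative. [folklore] -/
theorem good_of_mem_reach {S : List (Fin n)} (h1 : oneMulB n w T = true) (hS : assocGenB n w T S = true) :
    ∀ (k : ℕ) {g : Fin n}, g ∈ reach n w T S k → ∀ y z : TG n w T I, (⟨g⟩ : TG n w T I) * (y * z) = ⟨g⟩ * y * z := by
  intro k
  induction k with
  | zero =>
    intro g hg
    simp only [reach, List.mem_singleton] at hg
    subst hg
    exact good_one (one_mul_of_check h1)
  | succ k ih =>
    intro g hg
    simp only [reach, step, List.mem_dedup, List.mem_append, List.mem_flatMap, List.mem_map] at hg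
    rcases hg with hg | ⟨r, hr, s, hs, rfl⟩
    · exact ih hg
    · intro y z
      have := good_mul (ih hr) (good_of_mem (I := I) hS hs) y z
      simpa [mul_def] using this

/-- Associativity from the three checks. [folklore] -/
theorem mul_assoc_of_checks {S : List (Fin n)} (h1 : oneMulB n w T = true) (hS : assocGenB n w T S = true)
    (hG : genB n w T S = true) (x y z : TG n w T I) : x * y * z = x * (y * z) := by
  have hx : x.i ∈ reach n w T S n := by
    have := List.all_eq_true.mp hG x.i (List.mem_finRange _)
    simpa using this
  have := good_of_mem_reach (I := I) h1 hS n hx y z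
  cases x
  exact this.symm

/-- **A `Group` structure on a table type from four Boolean checks** (each meant to be discharged by `decide +kernel`).
[folklore] -/
@[reducible] def groupOfChecks (S : List (Fin n)) (h1 : oneMulB n w T = true) (h2 : invMulB n w T I = true)
    (hS : assocGenB n w T S = true) (hG : genB n w T S = true) : Group (TG n w T I) :=
  Group.ofLeftAxioms (mul_assoc_of_checks h1 hS hG) (one_mul_of_check h1) (inv_mul_of_check h2)

end TG

end Summit.MatrixMultiplication.OmegaCensus
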